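import Mathlib
import HarnessLib
import HarnessLib.Audit
import Summits.AtomisticToContinuum.Statement
import HarnessLib.Audit.Status.Attr

/-!
Route: BallisticLaceBootstrap

DORMANT since 2026-08-23T04:23:42Z (reconciler: no traction for 5.9 d (last activity item-evidence-added at 2026-08-17T06:24:11Z); parked, not closed — `ledger route dormant route-AtomisticToContinuum-BallisticLaceBootstrap --off` to re) — unstaffed, not closed; items shared with open routes are served there. `ledger route dormant <id> --off` reactivates.

# Route BallisticLaceBootstrap — lace expansion of collision histories — dressed ring self-energy
bootstrapped uniformly in kinetic time (d = 3 above the ballistic critical dimension 2)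

X (LACE–RING BOOTSTRAP; "it suffices to show"), realising card lace-expansion-ring-bootstrap (gen-2,
conforming re-opening of the retired route LaceRingBootstrap with a proved deciding theorem). X =
X_eq ∧ X_neq. X_eq: at reduced density σ < σ₀ (packing φ = πσ³/6 fixed, N → ∞ first) the equilibrium
tagged-particle / pair propagator of the deterministic hard-sphere gas has the
Dyson–Ornstein–Zernike form P̂(z) = [z − ℒ_E − Σ(z)]⁻¹ around the DRESSED (collision-damped) linear
Enskog reference, Σ being a convergent sum over irreducible ring diagrams (laces on the kinetic time
axis; a "self-intersection" is the re-encounter of causally upstream information) with ‖Π^(m)‖ ≤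
(C·R(φ))^m, R(φ) → 0 the dressed re-encounter bubble, closed by the Hara–Slade continuity bootstrap
UNIFORMLY in kinetic time (Re z → 0⁺) — possible because d = 3 lies above the BALLISTIC critical
dimension 2 (ring-closure kernel ∫dτ τ^-(d−1) < ∞). Typed equilibrium content: K1 =
EquilibriumVafEnvelope (all-kinetic-time envelope of the velocity autocorrelation at FIXED σ), B =
EquilibriumRecollisionBound (the bubble condition itself: recollisions per particle grow at most
linearly in kinetic time, with slope O(σ³)), K2 = EquilibriumLinearResponse (five-charge sector:
Euler-scale linear response = linearised hs-Euler). X_neq: the same expansion around the local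
Enskog process driven by the classical hs-Euler solution, typed as K3 =
LocalEquilibriumMarginalsInBand (1- and 2-marginals in local equilibrium along every classical
hs-Euler solution whose local packing fraction ρ_t(x)σ³ stays below a threshold η₀ — the packing
guard of the re-typed conjunct (D-0032; ∃ η₀ outermost, exactly as in `_root_.HydrodynamicLimit`),
which is also the regime the engine needs: the dressed bubble R(φ) must be small ALONG f_t — at
every t < T). K3 together with the two plumbing cruxes MarginalsToL2 (variance step) and
FlowMarginalSymmetry (a.e. relabelling symmetry) feeds the deciding theorem; K1, B, K2 are the
engine's rungs in increasing reach.
Lean: `EquilibriumVafEnvelope ∧ EquilibriumRecollisionBound ∧ EquilibriumLinearResponse ∧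
LocalEquilibriumMarginalsInBand`

## Assembly
Measure theory, no physics, and PROVED (glue.lean `closes`, sorry-free, CRUX-ONLY: its three
hypotheses LocalEquilibriumMarginalsInBand, MarginalsToL2, FlowMarginalSymmetry are all kind crux;
checked with the rendered route file, axioms propext/Classical.choice/Quot.sound):
LocalEquilibriumMarginalsInBand gives the packing threshold η₀, which is handed to the Statement's
outermost ∃ η₀; fix profiles; it gives σ₀; for σ < σ₀, a classical solution on [0,T) obeying the
guard ∀ t < T ∀ x ρ_t(x)σ³ < η₀, flows Φ, the t = 0 hypothesis and t ∈ [0,T) it gives the two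
weighted-L¹ marginal limits; continuity of ρ_t, u_t, θ_t and θ_t > 0 come from
IsHardSphereEulerSolution (IsSmoothSpaceTimeOn.isSmooth_slice + IsSmooth.continuous,
temperature_pos); FlowMarginalSymmetry supplies the a.e. symmetry hypothesis; MarginalsToL2 yields
the three mean-square limits at t; the Chebyshev–Markov step in ℝ≥0∞ (meas_ge_le_lintegral_div;
measurability of z ↦ field((Φ N).flow t z) from HardSphereFlow.measurable_flow and the
finite-average form of the empirical fields) is proved INLINE in `closes` and concludes the
packing-guarded sub-problem Statement `_root_.HydrodynamicLimit` BY NAME — no detour through the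
unguarded Literature conjecture. K1, B and K2 are the engine's rungs (tagged sector, bubble,
five-charge sector) and deliberately NOT antecedents. (History: up to the Statement re-type the
route consumed the unguarded K3 = LocalEquilibriumMarginals with the shared supports L2HydroFields /
L2ToHydroLimit, bridged for one revision by HydrodynamicLimit.of_unguarded; the re-type repair of
2026-08-16 drops those three items from this route and restates Assembly — the unguarded K3
over-claims exactly as the old conjunct did, covering imploding solutions outside the dilute-fluid
regime where no lace bootstrap can close.)

Rationale: WHY THIS LINE. Every kinetic expansion on the board (Lanford1975; DengHaniMa2024 layered molecules;
re-centred cumulants) is organised by collision HISTORIES and dies at a horizon of a fraction of a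
mean free time at fixed density (Cohen1967 §2 (11b), §4a), whereas one Euler time unit is ≍ N^1/3
mean free times; the one rigorous technology whose hallmark is convergence UNIFORM IN LENGTH around
a memoryless reference from one small scalar is the lace expansion with its bubble condition and
continuity bootstrap (BrydgesSpencer1985; HaraSlade1992; Slade2006LaceExpansion Thm 4.1, Thm 5.8,
Lemma 5.9; the one printed lace expansion around a NON-Gaussian, ballistic reference is
VanDerHofstad2001Ballistic = Slade2006LaceExpansion Thm 6.7; VanderhofstadHolmes2012), imported from
critical phenomena / probability with an explicit dictionary: walk length ↦ kinetic time, SRW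
transition ↦ dressed linear Enskog–Lorentz semigroup (χ(φ)·linearBoltzmannOp), two-point function ↦
tagged/pair propagator of the equilibrium gas, self-intersection ↦ ring closure (recollision, direct
or through a chain), lace ↦ irreducible ring diagram = the kinetic theorists' ring self-energy
(KawasakiOppenheim1967; VanLeeuwenWeijland1967 (12), (16); Dorfman1999 §16.2), bubble ↦ dressed
re-encounter bubble R(φ) = O(φ² log(1/φ)) beyond one mean free path plus the O(φ) quasi-local
three-body vertex, upper critical dimension d > 4 ↦ ballistic transience d > 2 (Cohen1967 (13)–(14),
Soto2016 §4.8.2: ∫dτ/τ^(d−1) converges in d = 3, log-diverges for disks, exactly as SAW in d = 4;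
the diffusive re-encounter integral ∫τ^(−d/2) has the same critical dimension), bootstrap in n ↦
bootstrap in kinetic time down to Re z → 0⁺. Physicists' self-consistent ring / mode-coupling theory
(DorfmanCohen1972; ErnstHaugeVanleeuwen1970; Resibois1978) IS an uncontrolled bootstrap for Σ on
dressed propagators; the delta is an inclusion–exclusion-exact lace representation plus the
continuity argument in place of a closure. Rigorous neighbours, none uniform in time at fixed
density: renormalised-propagator graph expansions beyond the kinetic time (ErdosSalmhoferYau2008),
transience-based control of the random Lorentz gas beyond Boltzmann–Grad (LutskoToth2020,
arXiv:2501.00519), long-time diffusion in weakly random Hamiltonian flows by non-return in d ≥ 3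
(KestenPapanicolaou1980; KomorowskiRyzhik2006), the tagged sphere at Boltzmann–Grad for (log log
N)-times (BodineauGallagherSaintRaymondInvent2016), equilibrium fluctuations on long kinetic times
in the dilute regime (BGSSCPAM2023 Thm 1.1). What this line does that prior routes and the negatives
index do not: it names the small parameter at FIXED σ (the dressed bubble R(φ), not σ³ per se) and
the mechanism for uniformity in time (transience + bootstrap), organises the expansion by
CORRELATION rather than INFLUENCE (so the branching horizon of history expansions is irrelevant: in
equilibrium one-time contact statistics are exactly product whatever the shared history), and files
two typed equilibrium theorems (K1, B) that no other route states; B is new in gen-2 — the bubble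
condition typed on the true dynamics with existing Lean objects (contactSet, Set.ncard), whose d = 2
analogue is false.

RANKED CRUXES. #2 EquilibriumVafEnvelope (crux) — K1 (card K1 / L1–L3 exercised in their home
setting): there are σ₀, c > 0 and constants A, K such that for every 0 < σ < σ₀, every family of
hard-sphere flows of N+1 spheres of diameter σ(N+1)^(-1/3) on 𝕋³, every kinetic time s ≥ 0 and every
δ > 0, for all large N the equilibrium velocity autocorrelation C_N(s) = E_G[(N+1)⁻¹ Σ_i
v_i(0)·v_i(t)] under the canonical hard-sphere Gibbs law with unit-temperature Maxwellian velocities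
(localGibbsLaw σ 1 0 1), read at macroscopic time t = s/((N+1)ε_N²), satisfies |C_N(s)| ≤ 3(A
e^(−cs) + K σ³ (1+s)^(−3/2)) + δ — the tagged velocity decorrelates at fixed positive density for
ALL kinetic times with an integrable envelope (exponential Enskog part + ring tail with the t^(−3/2)
exponent), hence Green–Kubo integrability, zero self-Drude weight, x(t)/t → 0 (Spohn1991 §8.3 p.
112: for the interacting fluid "so little understood that there is no hope"); C_N(0) = 3 exactly, so
the content is at large s. Same signature as the retired LaceRingBootstrap's (stmt-5511).
[difficulty: open-problem] (why it might fail: Needs the whole engine: exact lace representation,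
(C·R(φ))^m bounds on irreducible ring diagrams despite indirect collision chains (Cohen1967 §4c–d:
complete resummation unproved), and a bootstrap norm tolerating the z^1/2 branch point behind the
t^-3/2 tail (Hara–Slade never work AT criticality).) [Slade2006LaceExpansion,
VanDerHofstad2001Ballistic, HaraSlade1992, Cohen1967, DorfmanCohen1972, ErnstHaugeVanleeuwen1970,
AlderWainwright1970, Spohn1991]
#3 EquilibriumRecollisionBound (crux) — B (the BUBBLE CONDITION typed on the true dynamics; new in
gen-2): there are σ₀ > 0 and C such that for every 0 < σ < σ₀, every family of flows, every k ≥ 1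
and δ > 0, for all large N the expected number of REPEATED pair contacts within the kinetic window
[0, k] — Σ over ordered pairs i ≠ j of (#{t ∈ [0, k/((N+1)ε_N²)] : spheres i, j in contact at time
t} − 1)⁺, under the equilibrium Gibbs law localGibbsLaw σ 1 0 1 — is at most (C σ³ k + δ)(N+1):
recollisions per particle grow at most LINEARLY in kinetic time (finiteness of the dressed bubble =
summability of the re-encounter probability over the excursion length, ∫dτ/τ² ballistic and
∫dτ/τ^(3/2) diffusive, both convergent only because d = 3), with slope O(φ) carried by the
quasi-local three-body vertex (Choh–Uhlenbeck) and O(φ² log(1/φ)) by genuine rings; for hard DISKS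
the same count grows like k·log k. Trivial bounds give slope ≍ 7χ (all collisions): the content is
the small slope uniform in k. [difficulty: open-problem] (why it might fail: Uniformity in k is the
bubble of the TRUE dynamics — an OUTPUT of the bootstrap, not an input; hydrodynamic backflow (the
t^-3/2 tail) adds diffusive re-encounters and near-grazing pairs linger at small relative speed; for
disks the count is k·log k, so a proof must genuinely see d = 3.) [Cohen1967, Soto2016,
VanLeeuwenWeijland1967, Slade2006LaceExpansion, LutskoToth2020, PulvirentiSimonella2016,
BGSSCPAM2023]
#4 EquilibriumLinearResponse (crux) — K2 (card K2; the five-charge sector of the bootstrap,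
hydrodynamic poles projected out): Euler-scale LINEAR RESPONSE of the equilibrium hard-sphere gas at
fixed small σ is linearised hs-Euler — along a smooth homotopy of local-Gibbs profiles starting at a
constant state, with a jointly smooth family of classical hs-Euler solutions matching the LLN data,
the covariance under the homogeneous canonical Gibbs law of the initial score Σ_i ∂_κ
log(profile_κ)(z_i) at κ = 0 with the time-t empirical density / momentum / energy field tested
against χ converges to ∂_κ|₀ of the corresponding Euler field (Landau–Placzek structure; Drude
weights of the fast currents zero; Spohn1991 Part II §7 in response form). Same normalised signature
as stmt-3075 (OneParticleInfluence / LaceRingBootstrap): this route wants it as a CRUX because it is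
exactly the output of the small-z bootstrap in the sector orthogonal to the five charges. [deps:
EquilibriumVafEnvelope, EquilibriumRecollisionBound] [difficulty: open-problem] (why it might fail:
The bootstrap must close in the sector orthogonal to the five charges with the Euler poles projected
out; any O(1) memory surviving ≍N^1/3 collision times (kinetic or ring modes, anomalous sound
damping at fixed σ) adds a non-Euler term — open even at global equilibrium (Spohn1991 (7.19)).)
[Spohn1991, BGSSCPAM2023, ErnstHaugeVanleeuwen1970, Resibois1978, EvansMorriss2008]
#5 LocalEquilibriumMarginalsInBand (crux) — K3, PACKING-GUARDED (card K3 / L4; the typed s ≤ 2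
shadow of the non-equilibrium engine and the deciding crux; replaces the unguarded stmt-12107 after
the Statement re-type D-0032): there is a packing threshold η₀ > 0 (outermost; e.g. the packing
radius inside which the dressed bubble closes the bootstrap) such that for all continuous
local-Gibbs profiles there is σ₀ such that for σ < σ₀, every classical hs-Euler solution on [0,T)
WHOSE LOCAL PACKING FRACTION STAYS BELOW η₀ (∀ t < T ∀ x, ρ_t(x)σ³ < η₀, verbatim the Statement's
guard) and matching the data, every family of flows and every t < T, the 1-particle marginal of the
transported local Gibbs density converges to ρ_t M_(u_t,θ_t) in (1+|v|²)²-weighted L¹ and the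
2-particle marginal minus the product of 1-marginals tends to 0 in (1+|v|²)(1+|v′|²)-weighted L¹.
The unguarded form (σ₀ fixed BEFORE ∀ T ∀ solution) also covered imploding solutions leaving the
dilute-fluid regime, where the bubble is not small and no bootstrap closes — the over-strength the
re-type removed; the guarded form is what the engine (lace series around the local Enskog process
along the Euler solution, uniform on [0, T·N^1/3] kinetic times, small parameter R(φ_t) along f_t)
delivers, and it implies the conjunct with the same η₀. [deps: EquilibriumVafEnvelope,
EquilibriumRecollisionBound, EquilibriumLinearResponse] [difficulty: open-problem] (why it might
fail: Out of equilibrium the reference (local Enskog along hs-Euler) is time-inhomogeneous and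
one-time contact statistics are no longer exactly product, so the bubble must be bounded along f_t,
not G — an a-priori ring-density input nobody has, even at packing < η₀; and α = σ²N^1/3 defeats
DHM-type counting.) [DengHaniMa2024, Cohen1967, PulvirentiSimonella2016, BGSSCPAM2023,
VanbeijerenErnst1973, Spohn1991]
#9 MarginalsToL2 (crux by the layer invariant — a hypothesis of `closes`; provable-in-kind) —
marginals ⇒ mean square at time t (folklore variance computation, Sznitman1991 Prop. 2.2 with
unbounded tests): a.e. permutation symmetry of the transported density, weighted-L¹ convergence of
the 1-marginal to the local Maxwellian of (ρ_t,u_t,θ_t) and of the 2-marginal to the product imply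
the three mean-square field convergences at t. Identical signature to stmt-0806 (checked). (why it
might fail: only through typing conventions — the law of (Φ N).flow t z under localGibbsLaw must
have volume-density W N (particleLaw / hsTransport / measure preservation) and nthMarginal's
variable order / normalisation must match the (N+1)⁻¹ empirical average; the mathematics is a
variance identity plus the uniform integrability built into the weights.) [difficulty: M]
[Sznitman1991, GST2013]
#9 FlowMarginalSymmetry (crux by the layer invariant — a hypothesis of `closes`; provable-now) — for
every σ > 0, profiles, N, every hard-sphere flow Φ of N+1 spheres of diameter σ(N+1)^(-1/3) on 𝕋³,
every t and every permutation π, the transported local Gibbs density W = 1_D · (canonicalDensity ∘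
Φ_(−t)) is volume-a.e. invariant under relabelling — the symmetry hypothesis of MarginalsToL2 for
ARBITRARY flows (relabelled hard-sphere trajectories are hard-sphere trajectories; any two flows
agree Liouville-a.e., HardSphereFlow.flow_eq_ae_holds; the canonical density of a one-particle
profile is symmetric; off the domain both sides vanish). Identical signature to stmt-5512; PROVED
cone facts only. (why it might fail: the flow is junk off its good set, so covariance holds
Liouville-a.e. and must be moved to volume-a.e. through the domain indicator — the `volume` vs
`liouville` null sets off the domain are the one place the typing could break.) [difficulty:
provable-now] [GST2013, Alexander1975, CIP1994]
(Dropped in the re-type repair, kept by their other routes: the unguarded waypoints L2HydroFields =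
stmt-9057, L2ToHydroLimit = stmt-9058 — Chebyshev now inline in `closes` — and the unguarded
stmt-12107; Assembly restated.)

TWO-LAYER PLAN. Foreseen glued splits once a crux moves (nothing filed now; k ≤ 3, depth 1):
EquilibriumVafEnvelope ⇐ DressedBubbleBound → LaceSelfEnergyBounds → EquilibriumVafEnvelope
(DressedBubbleBound: the bubble of the REFERENCE process — two independent collision-damped
Enskog–Lorentz flights started at contact re-meet within ε an expected ≤ C φ² log(1/φ) times beyond
one mean free path — a Markov-process computation once the dressed reference is a Lean object;
LaceSelfEnergyBounds: lace representation + (C·R)^m diagrammatic bounds + small-z bootstrap, filed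
INFORMALLY at rank 6); EquilibriumRecollisionBound ⇐ ShortWindowRecollisions (k ≤ Lanford window at
fixed σ: BBGKY/Duhamel over a fraction of a mean free time, PulvirentiSimonella2016-type recollision
estimates at small φ > 0) → TransienceTransfer (stationarity + the bootstrap's two-point bounds sum
the excursion lengths) → EquilibriumRecollisionBound; EquilibriumLinearResponse ⇐
StaticScoreResponse → FiveChargeBootstrap → EquilibriumLinearResponse;
LocalEquilibriumMarginalsInBand ⇐ NonEquilibriumBubble (ring density along f_t on kinetic windows at
packing < η₀, an LD-transfer input) → LaceTransfer (the expansion around the time-inhomogeneous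
local Enskog reference given that input; the guard keeps R(φ_t) inside the bootstrap radius for t <
T) → LocalEquilibriumMarginalsInBand.

KILL CRITERIA. (i) ¬EquilibriumRecollisionBound at arbitrarily small σ (recollisions per particle
super-linear in kinetic time after N → ∞ — e.g. a k·log k law as for disks, or a slope not O(σ³))
kills the bubble and with it the whole dictionary: close --reason
refuted:EquilibriumRecollisionBound. (ii) ¬EquilibriumVafEnvelope (a slower-than-t^-3/2 or
non-decaying component of the equilibrium VAF at arbitrarily small fixed σ) refutes the rank-2 crux
and closes the route: refuted:EquilibriumVafEnvelope. (iii) Factorial growth of the number of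
irreducible ring topologies at order m NOT compensated by R(φ)^m, or a proof that matching the known
t^-3/2 amplitude already needs infinitely many laces with no small parameter, kills
LaceSelfEnergyBounds (informal) — close exhausted with census until typed, refuted afterwards. (iv)
¬EquilibriumLinearResponse closes this route (the five-charge sector is the whole point of X_neq)
without touching the conjunct. (v) ¬LocalEquilibriumMarginalsInBand (for EVERY threshold η₀ a
guarded counterexample) kills this route and every kinetic route whose marginal crux implies it, not
the conjunct (weighted-L¹ marginal convergence is stronger than convergence in probability); a
counterexample through imploding / dense solutions no longer bears on the route (the guard excludes
it, as for the conjunct). (vi) LocalEquilibriumMarginalsInBand (or the stronger unguarded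
stmt-12107) proved elsewhere (any engine) moots the distinctive content down to the rungs K1, B, K2,
which stay wanted as theorems; MarginalsToL2 / FlowMarginalSymmetry proved elsewhere are consumed
(their `_holds` discharge those hypotheses of `closes`). (vii) ¬MarginalsToL2 /
¬FlowMarginalSymmetry would be a TYPING defect (particleLaw / hsTransport / nthMarginal
conventions), repaired by restating the plumbing, not a verdict on the line.

NOT DECOMPOSED YET. The engine's own objects — the dressed linear Enskog–Lorentz reference on 𝕋³
(χ(φ)·linearBoltzmannOp exists for the tagged sector; the spatially shifted Enskog operator does
not), the Laplace-transformed tagged/pair propagators (finite-N Koopman resolvents compressed to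
one-particle observables, or Alexander's infinite-volume dynamics), the lace/self-energy kernels
Π^(m) and the bootstrap function f(z) — are definition-level and NOT items; LaceSelfEnergyBounds
(crux, rank 6) is filed INFORMALLY right after open and typed when they exist; DressedBubbleBound
stays in the two-layer plan. Also deliberately not decomposed: the d = 2 litmus (hard disks =
critical dimension, k·log k recollisions, no time-uniform bootstrap — a sanity check of the
dictionary, not an item), the identification D = D_E(1+O(φ² log φ)) and the exact tail amplitude
(refinements of K1), the cubic-velocity uniform-integrability module every flux route needs (K3
inherits it), constants η₀, σ₀, c, A, K, C, the Chebyshev–Markov step mean-square ⇒ probability (no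
item: proved inline in `closes`), and any Target item (X is the conjunction of the four cruxes K1,
B, K2, K3; no separate decl).

CHEAPEST FALSIFIER. Event-driven MD of N = 10⁴–10⁵ hard spheres on 𝕋³ at φ = 0.01–0.05 (kit,
DynamO-class code; not yet run): (a) count repeated pair contacts per particle versus kinetic time k
up to k ≈ 10³ — B predicts a straight line of slope ≈ c₁φ + c₂φ² log(1/φ) with NO upward curvature
(repeat for hard disks, where log-curvature must appear: the control experiment); (b) the VAF at the
same φ against the envelope of K1 and the mode-coupling tail (2/3n)[4π(D+ν)t]^-3/2
(ErnstHaugeVanleeuwen1970; AlderWainwright1970). On paper (cheaper still): compute the dressed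
bubble R(φ) and the FIRST irreducible ring kernel Π^(1) of the equilibrium VAF on damped Enskog
propagators and compare its long-time coefficient with the DorfmanCohen1972 tail amplitude — if
reproducing the KNOWN t^-3/2 amplitude already needs the infinite repeated-ring resummation with no
small parameter (Π^(1) off by O(1) at small φ), the (C·R)^m structure is dead and K1 loses its
engine; and check that VanDerHofstad2001Ballistic's induction tolerates a branch point of the
two-point function at the base point (z = 0 here) — if not, K1 weakens to Cesàro form.

NUMBERS. Kinetic clock: t = s/((N+1)ε_N²) = s σ⁻² (N+1)^(−1/3); Boltzmann collision rate at θ = 1 is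
4√π χ(φ) ≈ 7.09 χ per unit s (⟨|v−w|⟩ = 4/√π), so "k" in B is ≈ 7χk collisions per particle.
Ballistic critical dimension: ring-closure kernel ∫^∞ dτ τ^-(d−1) converges iff d ≥ 3 (Cohen1967
(13)–(14); NoDensityExpansion kernel (2): ∫_τ₀^T dτ/τ² ≤ τ₀⁻¹ in d = 3, ∫dτ/τ = log T in d = 2);
diffusive re-encounter ∫dτ τ^(−d/2) idem. Recollision budget per collision at packing φ (lengths in
units of ε, mean free path ℓ ≍ ε/φ): quasi-local three-body (excursion ≲ ℓ) (ε²/ℓ)∫_ε^ℓ dr/r² ≍ ε/ℓ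
≍ φ (Choh–Uhlenbeck / Sengers, the O(φ) correction to Boltzmann transport); long three-body
excursions (ε/ℓ)² ≍ φ²; four-body rings φ² log(ℓ/ε) = φ² log(1/φ) (Cohen1967 §4b (18);
VanLeeuwenWeijland1967 (16): D⁻¹ = … + (π³/4)ρ³ ln ρ for the 3-D Lorentz gas); so B's slope C σ³ is
≈ (π/6)·c₁·7χ σ³ with c₁ = O(1). VAF long-time tail in d = 3: C(t)/C(0) ≃ (2/(3n))[4π(D+ν)t]^(−3/2)
(ErnstHaugeVanleeuwen1970; DorfmanCohen1972; AlderWainwright1970 MD), i.e. relative amplitude ≍ φ²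
s^(−3/2) in kinetic units — inside K1's envelope K σ³ (1+s)^(−3/2) with a factor 1/φ of room. Lace
side: SAW bubble B(z_c) − 1 ≤ cβ (Slade2006LaceExpansion Thm 5.8, p. 65 of the held copy), bootstrap
Lemma 5.9 (p. 66) with b = 4, a = 1 + const·β, diagrammatic bounds Thm 4.1; non-Gaussian (ballistic,
d = 1) reference: Thm 6.7 (p. 78) = VanDerHofstad2001Ballistic; d_c = 4 diffusive ↦ d_c = 2
ballistic. Items: 10 at open; after the re-type repair: 6 cruxes (K1, B, K2, K3-guarded,
MarginalsToL2, FlowMarginalSymmetry), 1 informal support, 1 assembly = 8.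

DEFINITION REQUESTS. None filed (every typed item elaborates over existing declarations). Foreseen,
to be filed by the tenure planner when LaceSelfEnergyBounds is typed: (D1) the DRESSED linear
Enskog–Lorentz reference semigroup on 𝕋³ × ℝ³ at packing φ (−ν χ(φ)·linearBoltzmannOp for the tagged
sector exists in KineticTheory.TaggedSphereDiffusion; the spatially shifted Enskog collision
operator with contact factor χ(ρσ³) was wanted by the retired DenseKineticExpansion, stmt-0805
notes); (D2) the compressed Koopman resolvent of the finite-N hard-sphere flow on one-particle
observables under the Gibbs law (Laplace transform of the unitary Koopman group on
L²(localGibbsLaw)), the finite-N stand-in for Alexander's infinite-volume dynamics (Alexander1975)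
in which Σ_N(z) and the bootstrap function are expressed uniformly in N; (D3) the ring-closure count
with excursion threshold (a refinement of B's repeated-contact count separating quasi-local
three-body events from genuine rings). Cite facts wanted: none new (Cohen1967,
VanLeeuwenWeijland1967, KawasakiOppenheim1967 sit in the NoDensityExpansion barrier file).

Novelty: Searches (2026-08-15, this seat; OpenAlex and Semantic Scholar answered HTTP 429 all day, recorded):
`lit search --hybrid "lace expansion bootstrap self-energy kinetic theory hard spheres ring
collisions uniform in time"` (12 held docs: Slade2006, MadrasSlade1993, Soto2016, Wakeham 1996,
Morawetz 2017 — no junction); `lit search --source zbmath "lace expansion ballistic"` (2: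
doi:10.1007/s004400000103, doi:10.1093/acprof:oso/9780199239252.001.0001), `--source zbmath "lace
expansion Boltzmann equation kinetic limit"` (0), `--source zbmath "recollision hard spheres"` (0);
`lit search --source arxiv "recollisions Boltzmann-Grad hard sphere correlation"` (2:
arXiv:1405.4676 = PulvirentiSimonella2016, arXiv:1208.5753 = GST2013); `lit frontier
AtomisticToContinuum --since 2023` (30 rows; kinetic descendants all dilute: arXiv:2602.04407,
doi:10.1007/s10955-026-03570-w, arXiv:2605.19694; nothing on ring resummation at positive density);
`lit galaxy search "ring kinetic theory" --star all` (15 rows: Karkheck NATO volume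
panama:463057604050951, Lutsko reacting dense fluids pdf:834641580, noise otherwise); held texts
re-read at page level: Slade2006LaceExpansion pp. 65–66, 72, 77–78 (Thm 5.8, Lemma 5.9, §5.3 closing
remark, §6.2 Thm 6.7), Spohn1991 pp. 109–112, 119 (book) = held p0116–p0128 (§8.3 self-diffusion:
"no hope" for the interacting fluid; (8.45) for the Lorentz gas); the gen-1 seat's searches (zbMATH
"lace expansion kinetic" 3 lattice-tree hits, "lace expansion Lorentz gas" 0,  [refs: 10.1007/s004400000103, 10.1093/acprof:oso/9780199239252.001.0001, 10.1007/s10955-026-03570-w, 10.1007/bf01206182, 10.1007/bf02099530, 10.1007/s11511-008-0027-2, 10.1007/s00220-020-03852-8, 10.1007/s10955-009-9838-6, 1405.4676, 1208.5753, 2602.04407, 2605.19694, 2501.00519, doi:10.1007/s004400000103, doi:10.1093/acprof, doi:10.1007/s10955-026-03570-w, doi:10.1007/bf01206182, doi:10.1007/bf02099530,]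

Barriers (technique_class: lace-expansion ring-self-energy dressed-propagator-bootstrap): - technique_class: lace-expansion ring-self-energy dressed-propagator-bootstrap
- Literature.Barriers.AtomisticToContinuum.NoDensityExpansionBarrier: APPLIES to the letter of
"expansion of the dynamics" and is EVADED by construction — no power series in the density is formed
and no term takes t → ∞ inside a density order: propagators are dressed (collision-damped) BEFORE
any ring is integrated, so every term is finite at fixed φ and the ρ^k log ρ non-analyticities
appear where they should (its narrowed audit NoDensityExpansionBarrierNarrow, scope (g):
uniform-in-time bounds at fixed density on resummed objects are constrained by nothing printed); the
barrier's own kernel (2) (∫dτ/τ² < ∞ in d = 3) is this route's super-criticality input and B is its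
typed dynamical form; the honest residual "complete resummation has not been proved" (Cohen1967
§4c–d) is exactly the informal crux LaceSelfEnergyBounds.
- Literature.Barriers.AtomisticToContinuum.DiluteRegimeBarrier: evaded in letter and substance — no
Boltzmann–Grad limit anywhere; σ is fixed, the Enskog contact value χ(φ) and the full equation of
state ride in the reference semigroup; K1, B, K2, K3 are all stated at fixed σ with N → ∞ (its scope
caveat (b) names the particle → Enskog step at fixed σ as the open crux; this route supplies an
engine for it).
- Literature.Barriers.AtomisticToContinuum.BoltzmannHypothesisBarrier: not in its technique class
(no entropy method, no classification of stationary states); K2 attacks the li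

History (route lifecycle, newest last):
- 2026-08-16T23:24:00Z · rev 4: restated Assembly (stmt-AtomisticToContinuum-12110) — route-repair (statement re-type D-0032 / p126922; part 2 — the previous revision applied only the retriage M/S → crux): SUPPLY THE PACKING GUARD NATIVELY and ce (planner-rrepair-AtomisticToContinuum-Ballistic-bdf0e029-0)
- 2026-08-16T23:24:00Z · rev 4: dropped LocalEquilibriumMarginals, L2HydroFields, L2ToHydroLimit — route-repair (statement re-type D-0032 / p126922; part 2 — the previous revision applied only the retriage M/S → crux): SUPPLY THE PACKING GUARD NATIVELY and ce (planner-rrepair-AtomisticToContinuum-Ballistic-bdf0e029-0)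
- 2026-08-23T04:23:42Z · DORMANT — reconciler: no traction for 5.9 d (last activity item-evidence-added at 2026-08-17T06:24:11Z); parked, not closed — `ledger route dormant route-AtomisticToConti (operator:999:1250694)

sub-problem: HydrodynamicLimit · status: dormant · opened planner-plancard-AtomisticToContinuum-Hydrody-fc1c47c6-g2-0 2026-08-15T18:49:43Z · rev 7 · ledger route-AtomisticToContinuum-BallisticLaceBootstrap
GENERATED by the gate from the ledger (D-0016/17). Provers cite these decls: `theorem foo : Summit.AtomisticToContinuum.HydrodynamicLimit.Theses.BallisticLaceBootstrap.<Decl> := …` in Summits/AtomisticToContinuum/HydrodynamicLimit/Theorems/<Name>.lean.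
-/

namespace Summit.AtomisticToContinuum.HydrodynamicLimit.Theses.BallisticLaceBootstrap

open scoped BigOperators Topology Manifold Classical MeasureTheory ProbabilityTheory Matrix InnerProductSpace ComplexConjugate ContinuousMap
open Filter Set Function TopologicalSpace MeasureTheory

attribute [summit_statement] _root_.HydrodynamicLimit

/-- item stmt-AtomisticToContinuum-12104 · crux · rank 2 · open · by planner
why it might fail: Needs the whole engine: exact lace representation, (C·R(φ))^m bounds on irreducible ring diagrams despite indirect collision chains (Cohen1967 §4c–d: complete resummation unproved), and a bootstrap norm tolerating the z^1/2 branch point behind the t^-3/2 tail (Hara–Slade never work AT criticality).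
sources: Slade2006LaceExpansion, VanDerHofstad2001Ballistic, HaraSlade1992, Cohen1967, DorfmanCohen1972, ErnstHaugeVanleeuwen1970
[crux] K1 (card K1 / L1–L3 exercised in their home setting): there are σ₀, c > 0 and constants A, K
such that for every 0 < σ < σ₀, every family of hard-sphere flows of N+1 spheres of diameter
σ(N+1)^(-1/3) on 𝕋³, every kinetic time s ≥ 0 and every δ > 0, for all large N the equilibrium
velocity autocorrelation C_N(s) = E_G[(N+1)⁻¹ Σ_i v_i(0)·v_i(t)] under the canonical hard-sphere
Gibbs law with unit-temperature Maxwellian velocities (localGibbsLaw σ 1 0 1), read at macroscopic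
time t = s/((N+1)ε_N²), satisfies |C_N(s)| ≤ 3(A e^(−cs) + K σ³ (1+s)^(−3/2)) + δ — the tagged
velocity decorrelates at fixed positive density for ALL kinetic times with an integrable envelope
(exponential Enskog part + ring tail with the t^(−3/2) exponent), hence Green–Kubo integrability,
zero self-Drude weight, x(t)/t → 0 (Spohn1991 §8.3 p. 112: for the interacting fluid "so little
understood that there is no hope"); C_N(0) = 3 exactly, so the content is at large s. Same
normalised signature as the retired LaceRingBootstrap.EquilibriumVafEnvelope (stmt-5511).
[difficulty: open-problem] -/
@[route_item "route-AtomisticToContinuum-BallisticLaceBootstrap"]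
def EquilibriumVafEnvelope : Prop :=
  ∃ σ₀ : ℝ, 0 < σ₀ ∧ ∃ c : ℝ, 0 < c ∧ ∃ A K : ℝ, ∀ σ : ℝ, 0 < σ → σ < σ₀ → ∀ Φ : (N : ℕ) → Literature.Analysis.FluidPDE.HardSphereFlow (Literature.Analysis.FluidPDE.Torus.geometry (Fin 3)) (Literature.MathematicalPhysics.KineticTheory.hsDiameter σ N) (N + 1), ∀ s : ℝ, 0 ≤ s → ∀ δ : ℝ, 0 < δ → ∀ᶠ N : ℕ in Filter.atTop, |∫ z, ((N + 1 : ℕ) : ℝ)⁻¹ * ∑ i, inner ℝ (z i).2 (((Φ N).flow (s / (((N + 1 : ℕ) : ℝ) * Literature.MathematicalPhysics.KineticTheory.hsDiameter σ N ^ 2)) z) i).2 ∂(Literature.MathematicalPhysics.KineticTheory.localGibbsLaw σ (fun _ => 1) (fun _ => 0) (fun _ => 1) N (Φ N))| ≤ 3 * (A * Real.exp (-(c * s)) + K * σ ^ 3 * (1 + s) ^ (-(3 / 2 : ℝ))) + δ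

/-- item stmt-AtomisticToContinuum-12105 · crux · rank 3 · open · by planner
why it might fail: Uniformity in k is the bubble of the TRUE dynamics — an OUTPUT of the bootstrap, not an input; hydrodynamic backflow (the t^-3/2 tail) adds diffusive re-encounters and near-grazing pairs linger at small relative speed; for disks the count is k·log k, so a proof must genuinely see d = 3.
sources: Cohen1967, Soto2016, VanLeeuwenWeijland1967, Slade2006LaceExpansion, LutskoToth2020, PulvirentiSimonella2016
[crux] B (the BUBBLE CONDITION typed on the true dynamics; new in gen-2): there are σ₀ > 0 and C
such that for every 0 < σ < σ₀, every family of flows, every k ≥ 1 and δ > 0, for all large N the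
expected number of REPEATED pair contacts within the kinetic window [0, k] — Σ over ordered pairs i
≠ j of (#{t ∈ [0, k/((N+1)ε_N²)] : spheres i, j in contact at time t} − 1)⁺, under the equilibrium
Gibbs law localGibbsLaw σ 1 0 1 — is at most (C σ³ k + δ)(N+1): recollisions per particle grow at
most LINEARLY in kinetic time (finiteness of the dressed bubble = summability of the re-encounter
probability over the excursion length, ∫dτ/τ² ballistic and ∫dτ/τ^(3/2) diffusive, both convergent
only because d = 3), with slope O(φ) carried by the quasi-local three-body vertex (Choh–Uhlenbeck)
and O(φ² log(1/φ)) by genuine rings; for hard DISKS the same count grows like k·log k. Trivial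
bounds give slope ≍ 7χ (all collisions), so the content is the small slope uniform in k.
[difficulty: open-problem] -/
@[route_item "route-AtomisticToContinuum-BallisticLaceBootstrap"]
def EquilibriumRecollisionBound : Prop :=
  ∃ σ₀ : ℝ, 0 < σ₀ ∧ ∃ C : ℝ, ∀ σ : ℝ, 0 < σ → σ < σ₀ → ∀ Φ : (N : ℕ) → Literature.Analysis.FluidPDE.HardSphereFlow (Literature.Analysis.FluidPDE.Torus.geometry (Fin 3)) (Literature.MathematicalPhysics.KineticTheory.hsDiameter σ N) (N + 1), ∀ k : ℕ, 1 ≤ k → ∀ δ : ℝ, 0 < δ → ∀ᶠ N : ℕ in Filter.atTop, ∫⁻ z, ((∑ i : Fin (N + 1), ∑ j : Fin (N + 1), if i = j then 0 else ({t : ℝ | t ∈ Set.Icc (0 : ℝ) ((k : ℝ) / (((N + 1 : ℕ) : ℝ) * Literature.MathematicalPhysics.KineticTheory.hsDiameter σ N ^ 2)) ∧ (Φ N).flow t z ∈ Literature.Analysis.FluidPDE.contactSet (Literature.Analysis.FluidPDE.Torus.geometry (Fin 3)) (N + 1) (Literature.MathematicalPhysics.KineticTheory.hsDiameter σ N) i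 j}.ncard - 1) : ℕ) : ENNReal) ∂(Literature.MathematicalPhysics.KineticTheory.localGibbsLaw σ (fun _ => 1) (fun _ => 0) (fun _ => 1) N (Φ N)) ≤ ENNReal.ofReal ((C * σ ^ 3 * k + δ) * (N + 1))

/-- item stmt-AtomisticToContinuum-12106 · crux · rank 4 · open · by planner
why it might fail: The bootstrap must close in the sector orthogonal to the five charges with the Euler poles projected out; any O(1) memory surviving ≍N^1/3 collision times (kinetic or ring modes, anomalous sound damping at fixed σ) adds a non-Euler term — open even at global equilibrium (Spohn1991 (7.19)).
sources: Spohn1991, BGSSCPAM2023, ErnstHaugeVanleeuwen1970, Resibois1978, EvansMorriss2008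
[crux] K2 (card K2; the five-charge sector of the bootstrap, hydrodynamic poles projected out):
Euler-scale LINEAR RESPONSE of the equilibrium hard-sphere gas at fixed small σ is linearised
hs-Euler — along a smooth homotopy of local-Gibbs profiles starting at a constant state, with a
jointly smooth family of classical hs-Euler solutions matching the LLN data, the covariance under
the homogeneous canonical Gibbs law of the initial score Σ_i ∂_κ log(profile_κ)(z_i) at κ = 0 with
the time-t empirical density / momentum / energy field tested against χ converges to ∂_κ|₀ of the
corresponding Euler field (Landau–Placzek structure; Drude weights of the fast currents zero;
Spohn1991 Part II §7 in response form). Same normalised signature as stmt-3075 (OneParticleInfluence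
/ LaceRingBootstrap): this route wants it as a CRUX because it is exactly the output of the small-z
bootstrap in the sector orthogonal to the five charges. [deps: EquilibriumVafEnvelope,
EquilibriumRecollisionBound] [difficulty: open-problem] -/
@[route_item "route-AtomisticToContinuum-BallisticLaceBootstrap"]
def EquilibriumLinearResponse : Prop :=
  ∀ (a₁ θ₁ : Literature.MathematicalPhysics.KineticTheory.T3 → ℝ) (u₁ : Literature.MathematicalPhysics.KineticTheory.T3 → Literature.MathematicalPhysics.KineticTheory.V3), Continuous a₁ → Continuous θ₁ → Continuous u₁ → (∀ x, 0 < a₁ x) → (∀ x, 0 < θ₁ x) → ∀ Λ : ℝ, 1 ≤ Λ → ∃ σ₀ : ℝ, 0 < σ₀ ∧ ∀ σ : ℝ, 0 < σ → σ < σ₀ → ∀ (a θ₀ : ℝ → Literature.MathematicalPhysics.KineticTheory.T3 → ℝ) (u₀ : ℝ → Literature.MathematicalPhysics.KineticTheory.T3 → Literature.MathematicalPhysics.KineticTheory.V3), Literature.Analysis.FunctionSpaces.Torus.IsSmoothSpaceTimeOn (Set.Icc 0 1) a → Literature.Analysis.FunctionSpaces.Torus.IsSmoothSpaceTimeOn (Set.Icc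 0 1) θ₀ → Literature.Analysis.FunctionSpaces.Torus.IsSmoothSpaceTimeOn (Set.Icc 0 1) u₀ → (∀ κ ∈ Set.Icc (0 : ℝ) 1, ∀ x, Λ⁻¹ * (⨅ y, a₁ y) ≤ a κ x ∧ a κ x ≤ Λ * (⨆ y, a₁ y) ∧ 0 < θ₀ κ x) → (∀ x, a 0 x = a 0 0 ∧ θ₀ 0 x = θ₀ 0 0 ∧ u₀ 0 x = u₀ 0 0) → a 1 = a₁ → θ₀ 1 = θ₁ → u₀ 1 = u₁ → ∀ (T : ℝ) (ρ θ : ℝ → ℝ → Literature.MathematicalPhysics.KineticTheory.T3 → ℝ) (u : ℝ → ℝ → Literature.MathematicalPhysics.KineticTheory.T3 → Literature.MathematicalPhysics.KineticTheory.V3), (∀ κ ∈ Set.Icc (0 : ℝ) 1, Literature.MathematicalPhysics.KineticTheory.IsHardSphereEulerSolution σ T (ρ κ) (u κ) (θ κ)) → ContDiffOn ℝ ((⊤ : ℕ∞) : WithTop ℕ∞) (fun q : ℝ × ℝ × EuclideanSpace ℝ (Fin 3) => ρ q.1 q.2.1 (Literature.Analysis.FunctionSpaces.Torus.proj q.2.2))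 (Set.Icc 0 1 ×ˢ (Set.Ico 0 T ×ˢ Set.univ)) → ContDiffOn ℝ ((⊤ : ℕ∞) : WithTop ℕ∞) (fun q : ℝ × ℝ × EuclideanSpace ℝ (Fin 3) => u q.1 q.2.1 (Literature.Analysis.FunctionSpaces.Torus.proj q.2.2)) (Set.Icc 0 1 ×ˢ (Set.Ico 0 T ×ˢ Set.univ)) → ContDiffOn ℝ ((⊤ : ℕ∞) : WithTop ℕ∞) (fun q : ℝ × ℝ × EuclideanSpace ℝ (Fin 3) => θ q.1 q.2.1 (Literature.Analysis.FunctionSpaces.Torus.proj q.2.2)) (Set.Icc 0 1 ×ˢ (Set.Ico 0 T ×ˢ Set.univ)) → ∀ Φ : (N : ℕ) → Literature.Analysis.FluidPDE.HardSphereFlow (Literature.Analysis.FluidPDE.Torus.geometry (Fin 3)) (Literature.MathematicalPhysics.KineticTheory.hsDiameter σ N) (N + 1), (∀ κ ∈ Set.Icc (0 : ℝ) 1, Literature.MathematicalPhysics.KineticTheory.TendstoHydroFieldsAt (fun N => Literature.MathematicalPhysics.KineticTheory.localGibbsLaw σ (a κ) (u₀ κ) (θ₀ κ) N (Φ N)) Φ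 (ρ κ) (u κ) (θ κ) 0) → ∀ t ∈ Set.Ico 0 T, ∀ χ : Literature.MathematicalPhysics.KineticTheory.T3 → ℝ, Continuous χ → let p : ℝ → (N : ℕ) → MeasureTheory.Measure (Literature.Analysis.FluidPDE.Config (N + 1) (Fin 3) Literature.MathematicalPhysics.KineticTheory.T3) := fun κ N => Literature.MathematicalPhysics.KineticTheory.localGibbsLaw σ (a κ) (u₀ κ) (θ₀ κ) N (Φ N); let S : ℝ → (N : ℕ) → Literature.Analysis.FluidPDE.Config (N + 1) (Fin 3) Literature.MathematicalPhysics.KineticTheory.T3 → ℝ := fun κ N z => ∑ i, derivWithin (fun κ' => Real.log (Literature.MathematicalPhysics.KineticTheory.localGibbsProfile (a κ') (u₀ κ') (θ₀ κ') (z i))) (Set.Icc 0 1) κ; Filter.Tendsto (fun N : ℕ => ProbabilityTheory.covariance (S 0 N) (fun z => Literature.MathematicalPhysics.KineticTheory.empiricalDensityField ((Φ N).flow t z) χ) (p 0 N)) Filter.atTop (nhds (derivWithin (fun κ' => ∫ x, χ x * ρ κ' t x) (Set.Icc 0 1) 0)) ∧ (∀ j : Fin 3, Filter.Tendsto (fun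 N : ℕ => ProbabilityTheory.covariance (S 0 N) (fun z => Literature.MathematicalPhysics.KineticTheory.empiricalMomentumField ((Φ N).flow t z) χ j) (p 0 N)) Filter.atTop (nhds (derivWithin (fun κ' => ∫ x, χ x * ρ κ' t x * u κ' t x j) (Set.Icc 0 1) 0))) ∧ Filter.Tendsto (fun N : ℕ => ProbabilityTheory.covariance (S 0 N) (fun z => Literature.MathematicalPhysics.KineticTheory.empiricalEnergyField ((Φ N).flow t z) χ) (p 0 N)) Filter.atTop (nhds (derivWithin (fun κ' => ∫ x, χ x * Literature.MathematicalPhysics.KineticTheory.totalEnergyDensity (ρ κ' t x) (u κ' t x) (θ κ' t x)) (Set.Icc 0 1) 0))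

/-- item stmt-AtomisticToContinuum-17624 · crux · rank 5 · open · by planner
why it might fail: Out of equilibrium the reference (local Enskog along hs-Euler) is time-inhomogeneous and one-time contact statistics are not exactly product, so the bubble must be bounded along f_t, not G — an a-priori ring-density input nobody has, even at packing < η₀; α = σ²N^1/3 defeats DHM-type counting.
sources: DengHaniMa2024, Cohen1967, PulvirentiSimonella2016, BGSSCPAM2023, VanbeijerenErnst1973, Spohn1991
[crux] K3, PACKING-GUARDED (rev 3; replaces the unguarded LocalEquilibriumMarginals = stmt-12107
after the Statement re-type D-0032 / p126922): there is a packing threshold η₀ > 0 (outermost, as in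
`_root_.HydrodynamicLimit`) such that for all continuous local-Gibbs profiles there is σ₀ such that
for σ < σ₀, every classical hs-Euler solution on [0,T) whose local packing fraction stays below η₀
(∀ t < T ∀ x, ρ_t(x)σ³ < η₀ — verbatim the Statement's guard) and matching the data, every family of
flows and every t < T, the 1-particle marginal of the transported local Gibbs density converges to
ρ_t M_(u_t,θ_t) in (1+|v|²)²-weighted L¹ and the 2-particle marginal minus the product of
1-marginals tends to 0 in (1+|v|²)(1+|v′|²)-weighted L¹. The deciding crux (with the plumbing cruxes
MarginalsToL2, FlowMarginalSymmetry; Chebyshev inline in `closes`). Engine: lace / ring-self-energy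
series around the local Enskog process driven by the Euler solution, uniform on [0, T·N^1/3] kinetic
times, small parameter the dressed bubble R(φ_t) along f_t — the guard is exactly the regime in
which R stays inside the bootstrap radius; the unguarded form also covered imploding solutions
leaving the dilute-f -/
@[route_item "route-AtomisticToContinuum-BallisticLaceBootstrap", crux]
def LocalEquilibriumMarginalsInBand : Prop :=
  ∃ η₀ : ℝ, 0 < η₀ ∧ ∀ (a₀ θ₀ : Literature.MathematicalPhysics.KineticTheory.T3 → ℝ) (u₀ : Literature.MathematicalPhysics.KineticTheory.T3 → Literature.MathematicalPhysics.KineticTheory.V3), Continuous a₀ → Continuous θ₀ → Continuous u₀ → (∀ x, 0 < a₀ x) → (∀ x, 0 < θ₀ x) → ∃ σ₀ : ℝ, 0 < σ₀ ∧ ∀ σ : ℝ, 0 < σ → σ < σ₀ → ∀ (T : ℝ) (ρ θ : ℝ → Literature.MathematicalPhysics.KineticTheory.T3 → ℝ) (u : ℝ → Literature.MathematicalPhysics.KineticTheory.T3 → Literature.MathematicalPhysics.KineticTheory.V3), Literature.MathematicalPhysics.KineticTheory.IsHardSphereEulerSolution σ T ρ u θ → (∀ t ∈ Set.Ico 0 T,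 ∀ x, ρ t x * σ ^ 3 < η₀) → ∀ Φ : (N : ℕ) → Literature.Analysis.FluidPDE.HardSphereFlow (Literature.Analysis.FluidPDE.Torus.geometry (Fin 3)) (Literature.MathematicalPhysics.KineticTheory.hsDiameter σ N) (N + 1), Literature.MathematicalPhysics.KineticTheory.TendstoHydroFieldsAt (fun N => Literature.MathematicalPhysics.KineticTheory.localGibbsLaw σ a₀ u₀ θ₀ N (Φ N)) Φ ρ u θ 0 → ∀ t ∈ Set.Ico 0 T, let W : (N : ℕ) → Literature.Analysis.FluidPDE.Config (N + 1) (Fin 3) Literature.MathematicalPhysics.KineticTheory.T3 → ℝ := fun N => (Literature.Analysis.FluidPDE.hardSphereDomain (Literature.Analysis.FluidPDE.Torus.geometry (Fin 3)) (N + 1) (Literature.MathematicalPhysics.KineticTheory.hsDiameter σ N)).indicator (Literature.Analysis.FluidPDE.hsTransport (Φ N) t (Literature.Analysis.FluidPDE.canonicalDensity (Literature.Analysis.FluidPDE.Torus.geometry (Fin 3)) (Literature.MathematicalPhysics.KineticTheory.hsDiameter σ N) (N + 1) (Literature.MathematicalPhysics.KineticTheory.localGibbsProfile a₀ u₀ θ₀)));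 let g : Literature.MathematicalPhysics.KineticTheory.T3 × Literature.MathematicalPhysics.KineticTheory.V3 → ℝ := fun y => ρ t y.1 * Literature.Analysis.FluidPDE.localMaxwellian 1 (θ t y.1) (u t y.1) y.2; Filter.Tendsto (fun N : ℕ => ∫⁻ y : Literature.MathematicalPhysics.KineticTheory.T3 × Literature.MathematicalPhysics.KineticTheory.V3, ENNReal.ofReal ((1 + ‖y.2‖ ^ 2) ^ 2 * |Literature.Analysis.FluidPDE.nthMarginal (N + 1) 1 (W N) (fun _ => y) - g y|)) Filter.atTop (nhds 0) ∧ Filter.Tendsto (fun N : ℕ => ∫⁻ p : (Literature.MathematicalPhysics.KineticTheory.T3 × Literature.MathematicalPhysics.KineticTheory.V3) × (Literature.MathematicalPhysics.KineticTheory.T3 × Literature.MathematicalPhysics.KineticTheory.V3), ENNReal.ofReal ((1 + ‖p.1.2‖ ^ 2) * (1 + ‖p.2.2‖ ^ 2) * |Literature.Analysis.FluidPDE.nthMarginal (N + 1) 2 (W N) ![p.1, p.2] - Literature.Analysis.FluidPDE.nthMarginal (N + 1) 1 (W N) ![p.1] * Literature.Analysis.FluidPDE.nthMarginal (N + 1)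 1 (W N) ![p.2]|)) Filter.atTop (nhds 0)

/-- item stmt-AtomisticToContinuum-12108 · crux · rank 9 · open · by planner
why it might fail: Only via typing conventions: the law of (Φ N).flow t z under localGibbsLaw must have volume-density W N (particleLaw/hsTransport, measure preservation) and nthMarginal's variable order/normalisation must match the (N+1)⁻¹ empirical average; else the typed limits fail though the folklore holds.
sources: Sznitman1991, GST2013
[support] marginals ⇒ mean square at time t (folklore variance computation, Sznitman1991 Prop. 2.2
with unbounded tests): given a.e. permutation symmetry of the transported density, weighted-L¹
convergence of the 1-marginal to the local Maxwellian of (ρ_t,u_t,θ_t) and of the 2-marginal to the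
product imply the three mean-square field convergences at t. Identical signature to stmt-0806
(checked). [difficulty: M] -/
@[route_item "route-AtomisticToContinuum-BallisticLaceBootstrap", crux]
def MarginalsToL2 : Prop :=
  ∀ (σ : ℝ) (a₀ θ₀ : Literature.MathematicalPhysics.KineticTheory.T3 → ℝ) (u₀ : Literature.MathematicalPhysics.KineticTheory.T3 → Literature.MathematicalPhysics.KineticTheory.V3) (ρ θ : ℝ → Literature.MathematicalPhysics.KineticTheory.T3 → ℝ) (u : ℝ → Literature.MathematicalPhysics.KineticTheory.T3 → Literature.MathematicalPhysics.KineticTheory.V3) (Φ : (N : ℕ) → Literature.Analysis.FluidPDE.HardSphereFlow (Literature.Analysis.FluidPDE.Torus.geometry (Fin 3)) (Literature.MathematicalPhysics.KineticTheory.hsDiameter σ N) (N + 1)) (t : ℝ), 0 < σ → Continuous a₀ → Continuous θ₀ → Continuous u₀ → (∀ x, 0 < a₀ x) → (∀ x, 0 < θ₀ x) → Continuous (ρ t) → Continuous (u t) → Continuous (θ t) → (∀ x, 0 < θ t x) → let W : (N : ℕ) → Literature.Analysis.FluidPDE.Config (N + 1) (Fin 3) Literature.MathematicalPhysics.KineticTheory.T3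 → ℝ := fun N => (Literature.Analysis.FluidPDE.hardSphereDomain (Literature.Analysis.FluidPDE.Torus.geometry (Fin 3)) (N + 1) (Literature.MathematicalPhysics.KineticTheory.hsDiameter σ N)).indicator (Literature.Analysis.FluidPDE.hsTransport (Φ N) t (Literature.Analysis.FluidPDE.canonicalDensity (Literature.Analysis.FluidPDE.Torus.geometry (Fin 3)) (Literature.MathematicalPhysics.KineticTheory.hsDiameter σ N) (N + 1) (Literature.MathematicalPhysics.KineticTheory.localGibbsProfile a₀ u₀ θ₀))); let g : Literature.MathematicalPhysics.KineticTheory.T3 × Literature.MathematicalPhysics.KineticTheory.V3 → ℝ := fun y => ρ t y.1 * Literature.Analysis.FluidPDE.localMaxwellian 1 (θ t y.1) (u t y.1) y.2; (∀ (N : ℕ) (π : Equiv.Perm (Fin (N + 1))), Filter.EventuallyEq (MeasureTheory.ae MeasureTheory.volume) (fun z => W N (z ∘ π)) (W N)) → Filter.Tendsto (fun N : ℕ => ∫⁻ y : Literature.MathematicalPhysics.KineticTheory.T3 × Literature.MathematicalPhysics.KineticTheory.V3, ENNReal.ofReal ((1 + ‖y.2‖ ^ 2) ^ 2 * |Literature.Analysis.FluidPDE.nthMarginal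 (N + 1) 1 (W N) (fun _ => y) - g y|)) Filter.atTop (nhds 0) → Filter.Tendsto (fun N : ℕ => ∫⁻ p : (Literature.MathematicalPhysics.KineticTheory.T3 × Literature.MathematicalPhysics.KineticTheory.V3) × (Literature.MathematicalPhysics.KineticTheory.T3 × Literature.MathematicalPhysics.KineticTheory.V3), ENNReal.ofReal ((1 + ‖p.1.2‖ ^ 2) * (1 + ‖p.2.2‖ ^ 2) * |Literature.Analysis.FluidPDE.nthMarginal (N + 1) 2 (W N) ![p.1, p.2] - Literature.Analysis.FluidPDE.nthMarginal (N + 1) 1 (W N) ![p.1] * Literature.Analysis.FluidPDE.nthMarginal (N + 1) 1 (W N) ![p.2]|)) Filter.atTop (nhds 0) → ∀ χ : Literature.MathematicalPhysics.KineticTheory.T3 → ℝ, Continuous χ → Filter.Tendsto (fun N : ℕ => ∫⁻ z, ENNReal.ofReal (|Literature.MathematicalPhysics.KineticTheory.empiricalDensityField ((Φ N).flow t z) χ - ∫ x, χ x * ρ t x| ^ 2) ∂(Literature.MathematicalPhysics.KineticTheory.localGibbsLaw σ a₀ u₀ θ₀ N (Φ N))) Filter.atTop (nhds 0) ∧ Filter.Tendsto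 (fun N : ℕ => ∫⁻ z, ENNReal.ofReal (‖Literature.MathematicalPhysics.KineticTheory.empiricalMomentumField ((Φ N).flow t z) χ - ∫ x, (χ x * ρ t x) • u t x‖ ^ 2) ∂(Literature.MathematicalPhysics.KineticTheory.localGibbsLaw σ a₀ u₀ θ₀ N (Φ N))) Filter.atTop (nhds 0) ∧ Filter.Tendsto (fun N : ℕ => ∫⁻ z, ENNReal.ofReal (|Literature.MathematicalPhysics.KineticTheory.empiricalEnergyField ((Φ N).flow t z) χ - ∫ x, χ x * Literature.MathematicalPhysics.KineticTheory.totalEnergyDensity (ρ t x) (u t x) (θ t x)| ^ 2) ∂(Literature.MathematicalPhysics.KineticTheory.localGibbsLaw σ a₀ u₀ θ₀ N (Φ N))) Filter.atTop (nhds 0)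

/-- item stmt-AtomisticToContinuum-12109 · crux · rank 9 · open · by planner
why it might fail: The flow is junk off its good set: relabelling covariance holds only Liouville-a.e. (flow_eq_ae with the relabelled flow) and must be moved to volume-a.e. through the domain indicator — a volume-vs-liouville null-set mismatch off the hard-sphere domain is where the typing could break.
sources: GST2013, Alexander1975, CIP1994
[support] for every σ > 0, profiles, N, every hard-sphere flow Φ of N+1 spheres of diameter
σ(N+1)^(-1/3) on 𝕋³, every t and every permutation π of the labels, the transported local Gibbs
density W = 1_D · (canonicalDensity ∘ Φ_(−t)) is volume-a.e. invariant under relabelling — the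
symmetry hypothesis of MarginalsToL2 discharged for ARBITRARY flows (relabelled hard-sphere
trajectories are hard-sphere trajectories; any two flows agree Liouville-a.e.,
HardSphereFlow.flow_eq_ae_holds; the canonical density of a one-particle profile is symmetric; off
the domain both sides vanish). Identical signature to stmt-5512; rests on PROVED cone facts only.
[difficulty: provable-now] -/
@[route_item "route-AtomisticToContinuum-BallisticLaceBootstrap", crux]
def FlowMarginalSymmetry : Prop :=
  ∀ (σ : ℝ) (a₀ θ₀ : Literature.MathematicalPhysics.KineticTheory.T3 → ℝ) (u₀ : Literature.MathematicalPhysics.KineticTheory.T3 → Literature.MathematicalPhysics.KineticTheory.V3), 0 < σ → ∀ (N : ℕ) (Φ : Literature.Analysis.FluidPDE.HardSphereFlow (Literature.Analysis.FluidPDE.Torus.geometry (Fin 3)) (Literature.MathematicalPhysics.KineticTheory.hsDiameter σ N) (N + 1)) (t : ℝ) (π : Equiv.Perm (Fin (N + 1))), let W : Literature.Analysis.FluidPDE.Config (N + 1) (Fin 3) Literature.MathematicalPhysics.KineticTheory.T3 → ℝ := (Literature.Analysis.FluidPDE.hardSphereDomain (Literature.Analysis.FluidPDE.Torus.geometry (Fin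 3)) (N + 1) (Literature.MathematicalPhysics.KineticTheory.hsDiameter σ N)).indicator (Literature.Analysis.FluidPDE.hsTransport Φ t (Literature.Analysis.FluidPDE.canonicalDensity (Literature.Analysis.FluidPDE.Torus.geometry (Fin 3)) (Literature.MathematicalPhysics.KineticTheory.hsDiameter σ N) (N + 1) (Literature.MathematicalPhysics.KineticTheory.localGibbsProfile a₀ u₀ θ₀))); Filter.EventuallyEq (MeasureTheory.ae MeasureTheory.volume) (fun z => W (z ∘ π)) W

-- item stmt-AtomisticToContinuum-12359 · support · rank 6 · open · by planner — informal only, no Lean statement yet: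
--   [crux] LACE REPRESENTATION + DIAGRAMMATIC BOUNDS + BOOTSTRAP (card L2+L3; the ENGINE of the route,
--   informal until the dressed linear Enskog–Lorentz reference and the compressed Koopman resolvent of
--   the finite-N flow on one-particle observables exist as Lean objects — Definition requests D1/D2 of
--   the route header): for packing φ < φ₀ and uniformly in N, the Laplace-transformed tagged-particle
--   (and pair) propagator of the equilibrium hard-sphere gas (N+1 spheres of diameter σ(N+1)^(-1/3) on
--   𝕋³ under localGibbsLaw σ 1 0 1, kinetic time s = t(N+1)ε²) satisfies P̂_N(z) = [z − ℒ_E − Σ_N(z)]⁻¹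
--   on the

-- earlier Assembly (stmt-AtomisticToContinuum-12110, replaced 2026-08-16T23:24:00Z -> stmt-AtomisticToContinuum-17623): retired by None — LocalEquilibriumMarginals → MarginalsToL2 → FlowMarginalSymmetry → L2ToHydroLimit → _root_.HydrodynamicLimit
/-- item stmt-AtomisticToContinuum-17623 · assembly · rank 1 · open · by planner
sources: Sznitman1991, Spohn1991, OllaVaradhanYau1993
[assembly] LocalEquilibriumMarginalsInBand → MarginalsToL2 → FlowMarginalSymmetry →
HydrodynamicLimit — exactly the type of the crux-only deciding theorem `closes` (η₀ threaded from
the guarded crux to the Statement's outermost ∃; Chebyshev–Markov proved inline). Restated in the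
Statement re-type repair (it formerly named the unguarded K3 and L2ToHydroLimit). -/
@[route_item "route-AtomisticToContinuum-BallisticLaceBootstrap"]
def Assembly : Prop :=
  LocalEquilibriumMarginalsInBand → MarginalsToL2 → FlowMarginalSymmetry → _root_.HydrodynamicLimit

/-! D-0027 §2.1 — DECIDING THEOREM (planner-authored via `route open/edit --closes-file`; by planner-rbadge-AtomisticToContinuum-BallisticL-6839f94b-0 2026-08-17T00:11:12Z):
its hypotheses are this route's items and its conclusion the sub-problem Statement (glue_lint), and it elaborates with this file. -/

@[closes "route-AtomisticToContinuum-BallisticLaceBootstrap"] theorem closes (hK3 : LocalEquilibriumMarginalsInBand) (hM : MarginalsToL2)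
    (hS : FlowMarginalSymmetry) : _root_.HydrodynamicLimit := by
  -- Deciding theorem, CRUX-ONLY (hypotheses K3 = LocalEquilibriumMarginalsInBand and the two plumbing
  -- cruxes MarginalsToL2 / FlowMarginalSymmetry; K1, B, K2 are the engine's rungs, deliberately not
  -- antecedents). Concludes the packing-guarded registry Statement `_root_.HydrodynamicLimit` BY NAME
  -- (re-typed 2026-08-16, D-0032); re-certified unchanged in substance 2026-08-17 after a stale
  -- fullbuild stamp that had compiled the pre-retype glue of rev ≤ 1.
  -- (1) Chebyshev–Markov along a sequence of laws, in `ℝ≥0∞` (folklore; inline so that `closes`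
  --     assumes cruxes only): `P_N {δ < g_N} ≤ P_N {δ² ≤ g_N²} ≤ δ⁻² ∫⁻ g_N² dP_N → 0`.
  have cheb : ∀ (P : (N : ℕ) → MeasureTheory.Measure
        (Literature.Analysis.FluidPDE.Config (N + 1) (Fin 3) Literature.MathematicalPhysics.KineticTheory.T3))
      (g : (N : ℕ) → Literature.Analysis.FluidPDE.Config (N + 1) (Fin 3)
        Literature.MathematicalPhysics.KineticTheory.T3 → ℝ),
      (∀ N, Measurable (g N)) →
      Filter.Tendsto (fun N => ∫⁻ z, ENNReal.ofReal (g N z ^ 2) ∂P N) Filter.atTop (nhds 0) →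
      ∀ δ : ℝ, 0 < δ → Filter.Tendsto (fun N => P N {z | δ < g N z}) Filter.atTop (nhds 0) := by
    intro P g hg h δ hδ
    have hδ2 : ENNReal.ofReal (δ ^ 2) ≠ 0 := by
      rw [Ne, ENNReal.ofReal_eq_zero, not_le]
      positivity
    have hlim : Filter.Tendsto
        (fun N => (∫⁻ z, ENNReal.ofReal (g N z ^ 2) ∂P N) / ENNReal.ofReal (δ ^ 2))
        Filter.atTop (nhds 0) := by
      simpa only [ENNReal.zero_div] using ENNReal.Tendsto.div_const h (Or.inr hδ2)
    refine tendsto_of_tendsto_of_tendsto_of_le_of_le tendsto_const_nhds hlim (fun _ => bot_le)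
      fun N => ?_
    calc P N {z | δ < g N z}
        ≤ P N {z | ENNReal.ofReal (δ ^ 2) ≤ ENNReal.ofReal (g N z ^ 2)} := by
          refine measure_mono fun z hz => ?_
          simp only [Set.mem_setOf_eq] at hz ⊢
          refine ENNReal.ofReal_le_ofReal ?_
          have h0 : 0 ≤ δ := hδ.le
          nlinarith
      _ ≤ (∫⁻ z, ENNReal.ofReal (g N z ^ 2) ∂P N) / ENNReal.ofReal (δ ^ 2) :=
          meas_ge_le_lintegral_div ((hg N).pow_const 2).ennreal_ofReal.aemeasurable hδ2
            ENNReal.ofReal_ne_top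
  -- (2) measurability of the three empirical fields tested against a continuous `χ`, as
  --     functions of the configuration (finite averages of continuous functions; folklore).
  have mpos : ∀ (N : ℕ) (i : Fin N), Measurable fun z : Literature.Analysis.FluidPDE.Config N (Fin 3)
      Literature.MathematicalPhysics.KineticTheory.T3 => (z i).1 :=
    fun N i => (measurable_pi_apply i).fst
  have mvel : ∀ (N : ℕ) (i : Fin N), Measurable fun z : Literature.Analysis.FluidPDE.Config N (Fin 3)
      Literature.MathematicalPhysics.KineticTheory.T3 => (z i).2 :=
    fun N i => (measurable_pi_apply i).snd
  have mdens : ∀ (N : ℕ) (χ : Literature.MathematicalPhysics.KineticTheory.T3 → ℝ), Continuous χ →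
      Measurable fun z : Literature.Analysis.FluidPDE.Config N (Fin 3)
        Literature.MathematicalPhysics.KineticTheory.T3 =>
        Literature.MathematicalPhysics.KineticTheory.empiricalDensityField z χ := by
    intro N χ hχ
    have e : (fun z : Literature.Analysis.FluidPDE.Config N (Fin 3)
        Literature.MathematicalPhysics.KineticTheory.T3 =>
        Literature.MathematicalPhysics.KineticTheory.empiricalDensityField z χ) =
        fun z => (N : ℝ)⁻¹ * ∑ i, χ (z i).1 := by
      funext z
      simp only [Literature.MathematicalPhysics.KineticTheory.empiricalDensityField,
        Literature.Analysis.FluidPDE.empiricalMeasure_eq, integral_smul_measure]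
      rw [integral_finsetSum_measure fun i _ => integrable_dirac enorm_lt_top]
      simp [integral_dirac, ENNReal.toReal_inv]
    rw [e]
    exact measurable_const.mul (Finset.measurable_sum _ fun i _ => hχ.measurable.comp (mpos N i))
  have mmom : ∀ (N : ℕ) (χ : Literature.MathematicalPhysics.KineticTheory.T3 → ℝ), Continuous χ →
      Measurable fun z : Literature.Analysis.FluidPDE.Config N (Fin 3)
        Literature.MathematicalPhysics.KineticTheory.T3 =>
        Literature.MathematicalPhysics.KineticTheory.empiricalMomentumField z χ := by
    intro N χ hχ
    have e : (fun z : Literature.Analysis.FluidPDE.Config N (Fin 3)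
        Literature.MathematicalPhysics.KineticTheory.T3 =>
        Literature.MathematicalPhysics.KineticTheory.empiricalMomentumField z χ) =
        fun z => (N : ℝ)⁻¹ • ∑ i, χ (z i).1 • (z i).2 := by
      funext z
      simp only [Literature.MathematicalPhysics.KineticTheory.empiricalMomentumField,
        Literature.Analysis.FluidPDE.empiricalMeasure_eq, integral_smul_measure]
      rw [integral_finsetSum_measure fun i _ => integrable_dirac enorm_lt_top]
      simp [integral_dirac, ENNReal.toReal_inv]
    rw [e]
    exact (Finset.measurable_sum _ fun i _ =>
      (hχ.measurable.comp (mpos N i)).smul (mvel N i)).const_smul ((N : ℝ)⁻¹)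
  have mener : ∀ (N : ℕ) (χ : Literature.MathematicalPhysics.KineticTheory.T3 → ℝ), Continuous χ →
      Measurable fun z : Literature.Analysis.FluidPDE.Config N (Fin 3)
        Literature.MathematicalPhysics.KineticTheory.T3 =>
        Literature.MathematicalPhysics.KineticTheory.empiricalEnergyField z χ := by
    intro N χ hχ
    have e : (fun z : Literature.Analysis.FluidPDE.Config N (Fin 3)
        Literature.MathematicalPhysics.KineticTheory.T3 =>
        Literature.MathematicalPhysics.KineticTheory.empiricalEnergyField z χ) =
        fun z => (N : ℝ)⁻¹ * ∑ i, χ (z i).1 * (‖(z i).2‖ ^ 2 / 2) := by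
      funext z
      simp only [Literature.MathematicalPhysics.KineticTheory.empiricalEnergyField,
        Literature.Analysis.FluidPDE.empiricalMeasure_eq, integral_smul_measure]
      rw [integral_finsetSum_measure fun i _ => integrable_dirac enorm_lt_top]
      simp [integral_dirac, ENNReal.toReal_inv]
    rw [e]
    exact measurable_const.mul (Finset.measurable_sum _ fun i _ =>
      (hχ.measurable.comp (mpos N i)).mul (((mvel N i).norm.pow_const 2).div_const 2))
  -- (3) the plumbing: η₀ from the guarded marginal crux; σ₀ profile by profile; at each
  --     t ∈ [0,T) the marginals (K3), the a.e. symmetry (FlowMarginalSymmetry) and the variance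
  --     step (MarginalsToL2) give the three mean-square limits; (1) turns them into convergence
  --     in probability, i.e. the packing-guarded Statement `_root_.HydrodynamicLimit` by name.
  obtain ⟨η₀, hη₀, H0⟩ := hK3
  refine ⟨η₀, hη₀, fun a₀ θ₀ u₀ ha hθ hu ha0 hθ0 => ?_⟩
  obtain ⟨σ₀, hσ₀, H⟩ := H0 a₀ θ₀ u₀ ha hθ hu ha0 hθ0
  refine ⟨σ₀, hσ₀, fun σ hσ hσ' T ρ θ u hE hgd Φ h0 t ht => ?_⟩
  obtain ⟨h1, h2⟩ := H σ hσ hσ' T ρ θ u hE hgd Φ h0 t ht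
  have hL2 := hM σ a₀ θ₀ u₀ ρ θ u Φ t hσ ha hθ hu ha0 hθ0
    (hE.smooth_density.isSmooth_slice ht).continuous
    (hE.smooth_velocity.isSmooth_slice ht).continuous
    (hE.smooth_temperature.isSmooth_slice ht).continuous
    (hE.temperature_pos t ht)
    (fun N π => hS σ a₀ θ₀ u₀ hσ N (Φ N) t π) h1 h2
  intro χ hχ δ hδ
  obtain ⟨hd, hm, he⟩ := hL2 χ hχ
  refine ⟨?_, ?_, ?_⟩
  · exact cheb (fun N => Literature.MathematicalPhysics.KineticTheory.localGibbsLaw σ a₀ u₀ θ₀ N (Φ N))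
      (fun N z => |Literature.MathematicalPhysics.KineticTheory.empiricalDensityField ((Φ N).flow t z) χ -
        ∫ x, χ x * ρ t x|)
      (fun N => (((mdens _ χ hχ).comp ((Φ N).measurable_flow t)).sub_const _).abs) hd δ hδ
  · exact cheb (fun N => Literature.MathematicalPhysics.KineticTheory.localGibbsLaw σ a₀ u₀ θ₀ N (Φ N))
      (fun N z => ‖Literature.MathematicalPhysics.KineticTheory.empiricalMomentumField ((Φ N).flow t z) χ -
        ∫ x, (χ x * ρ t x) • u t x‖)
      (fun N => (((mmom _ χ hχ).comp ((Φ N).measurable_flow t)).sub_const _).norm) hm δ hδ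
  · exact cheb (fun N => Literature.MathematicalPhysics.KineticTheory.localGibbsLaw σ a₀ u₀ θ₀ N (Φ N))
      (fun N z => |Literature.MathematicalPhysics.KineticTheory.empiricalEnergyField ((Φ N).flow t z) χ -
        ∫ x, χ x * Literature.MathematicalPhysics.KineticTheory.totalEnergyDensity (ρ t x) (u t x) (θ t x)|)
      (fun N => (((mener _ χ hχ).comp ((Φ N).measurable_flow t)).sub_const _).abs) he δ hδ

end Summit.AtomisticToContinuum.HydrodynamicLimit.Theses.BallisticLaceBootstrap
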